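import Summits.CriticalPhenomena.PercolationContinuityZ3.Theorems.SubpolynomialBlocking.Negative.Strengthenings
import HarnessLib

/-!
# Crux `PercNonProliferation.SubpolynomialBlocking` (stmt-CriticalPhenomena-4446), line `root-trick-wall-patch` —
# stub `stub_cruxIffExponentZero`: the crux ⟺ the critical blocking exponent is zero

Helper file for the crux skeleton of line `root-trick-wall-patch` (lead prover-line-stmt-CriticalPhenomena-4446-c3-0).
With `u_n = Negative.blockProb 3 p_c n = P_{p_c(ℤ³)}(Λ_n ↮ ∂ⁱⁿΛ_{2n} in Λ_{2n})` the crux reads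
`∀ s > 0, ∀ᶠ n, n^{-s} ≤ u_n` (`Negative.crux_iff`, `Negative.subpolynomialBlockingAt_iff`, both definitional).
Since `0 < u_n ≤ 1` for `n ≥ 1` (`Negative.blockProb_criticalProb_three_pos`, `Negative.blockProb_le_one`), this is
equivalent to the LIMIT FORM `log (1/u_n) / log n → 0`, i.e. "the critical annulus-blocking exponent of `ℤ³` is `0`".
Pure real analysis; the companion limit `n⁻² log (1/u_n) → 0` (what IS known) is
`tendsto_log_inv_blockProb_div_sq` (`…SubpolynomialBlockingSubsurfaceTension.lean`).

## Results

* `StubCruxIffExponentZero.rpow_neg_le_iff_log_inv_div_log_le` : for `1 < x`, `0 < u`: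
  `x^{-s} ≤ u ↔ log u⁻¹ / log x ≤ s`;
* `StubCruxIffExponentZero.log_inv_blockProb_div_log_nonneg` : `0 ≤ log (u_n)⁻¹ / log n`;
* `stub_cruxIffExponentZero` : **crux ⟺ `log (u_n)⁻¹ / log n → 0`** (registered signature).
-/

noncomputable section

namespace Summit.CriticalPhenomena.PercolationContinuityZ3.Theorems.SubpolynomialBlocking

open MeasureTheory Filter Topology
open Literature.Probability.Percolation Literature.Probability.LatticeModels
open Summit.CriticalPhenomena.PercolationContinuityZ3.Theorems.SubpolynomialBlocking.Negative

namespace StubCruxIffExponentZero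

/-- Taking logarithms in `x^{-s} ≤ u` (`1 < x`, `0 < u`): `x^{-s} ≤ u ↔ log u⁻¹ / log x ≤ s`. -/
theorem rpow_neg_le_iff_log_inv_div_log_le {x u : ℝ} (hx : 1 < x) (hu : 0 < u) (s : ℝ) :
    x ^ (-s) ≤ u ↔ Real.log u⁻¹ / Real.log x ≤ s := by
  have hlog : 0 < Real.log x := Real.log_pos hx
  rw [Real.rpow_le_iff_le_log (one_pos.trans hx) hu, Real.log_inv, div_le_iff₀ hlog]
  constructor <;> intro h <;> linarith

/-- The critical blocking exponent sequence is nonnegative: `0 ≤ log (u_n)⁻¹ / log n` for `n ≥ 1`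
(`0 < u_n ≤ 1` and `0 ≤ log n`). -/
theorem log_inv_blockProb_div_log_nonneg {n : ℕ} (hn : 1 ≤ n) :
    0 ≤ Real.log (blockProb 3 (criticalProbI 3) n)⁻¹ / Real.log n :=
  div_nonneg (Real.log_nonneg (one_le_inv_iff₀.2
    ⟨blockProb_criticalProb_three_pos hn, blockProb_le_one 3 (criticalProbI 3) n⟩))
    (Real.log_natCast_nonneg n)

end StubCruxIffExponentZero

open StubCruxIffExponentZero in
/-- **The crux ⟺ the critical blocking exponent is zero** (registered stub `stub_cruxIffExponentZero` of line
`root-trick-wall-patch`): `(∀ s > 0, ∀ᶠ n, n^{-s} ≤ u_n) ↔ log (u_n)⁻¹ / log n → 0`, where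
`u_n = P_{p_c(ℤ³)}(Λ_n ↮ ∂ⁱⁿΛ_{2n} in Λ_{2n})`. (→): for `ε > 0`, eventually `n^{-ε/2} ≤ u_n`, i.e.
`0 ≤ log (u_n)⁻¹ / log n ≤ ε/2 < ε`. (←): for `s > 0`, eventually `log (u_n)⁻¹ / log n < s`, i.e. `n^{-s} ≤ u_n`. -/
theorem stub_cruxIffExponentZero :
    Summit.CriticalPhenomena.PercolationContinuityZ3.Theses.PercNonProliferation.SubpolynomialBlocking ↔
      Tendsto (fun n : ℕ => Real.log (Negative.blockProb 3 (criticalProbI 3) n)⁻¹ / Real.log n)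
        atTop (𝓝 0) := by
  rw [crux_iff, subpolynomialBlockingAt_iff]
  constructor
  · intro h
    rw [tendsto_order]
    refine ⟨fun a ha => ?_, fun a ha => ?_⟩
    · filter_upwards [eventually_ge_atTop 1] with n hn
      exact lt_of_lt_of_le ha (log_inv_blockProb_div_log_nonneg hn)
    · filter_upwards [h (a / 2) (by linarith), eventually_ge_atTop 2] with n hn hn2
      have hx : (1 : ℝ) < n := by exact_mod_cast hn2
      have hle := (rpow_neg_le_iff_log_inv_div_log_le hx
        (blockProb_criticalProb_three_pos (by omega)) (a / 2)).1 hn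
      linarith
  · intro h s hs
    filter_upwards [h.eventually (gt_mem_nhds hs), eventually_ge_atTop 2] with n hn hn2
    have hx : (1 : ℝ) < n := by exact_mod_cast hn2
    exact (rpow_neg_le_iff_log_inv_div_log_le hx (blockProb_criticalProb_three_pos (by omega)) s).2 hn.le

end Summit.CriticalPhenomena.PercolationContinuityZ3.Theorems.SubpolynomialBlocking

end
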